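/-
Copyright (c) 2026 the pub-hodgecm-mathlib formalisation cell (harness21).  Prover seat hodgecm-mathlib-K2E4-p11 (g9): Track B «K2-LIT»,
hLiu418 = stmt-HodgeConjecture-24832, socket #41 KIND W, organ «Φ6b-ind» CONSUMER HEAD (LEAD F0P6-plan (g14) BATCH #178 (1); KW desk F0P2-p08 (g3)
(G3) 2026-09-05T00:42:11Z: index bytes `hidxᴴ = hidx`, `hidx.det.re < 0`): THE PER-PLACE ARCHIMEDEAN WHITTAKER LETTER `hW` AT AN INDEFINITE FRAMED
INDEX — the `hInd` slot of ★ `K2LiuKindWArchWhittakerLetterDispatch.hW_of_signCases`, HYPOTHESIS-FIRST on ONE jet-continuation letter `hJet` whose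
order-`0` instance is ★ (FILE 4 `K2LiuHermTwoXiIndefiniteContinuation`).  THEOREMS ONLY (no `def`, no `instance`, no `notation`, no `sorry`).
-/
import Summits.HodgeConjecture.HodgeConjecture.Theorems.K2LiuKindWArchWhittakerLetter                 -- ★ the DEFINITE head (frame algebra, chart, Iwasawa, Levi)
import Summits.HodgeConjecture.HodgeConjecture.Theorems.K2LiuKindWArchWhittakerLetterDispatch         -- ★ `hW_of_signCases` (the slot `hInd`)
import Summits.HodgeConjecture.HodgeConjecture.Theorems.K2LiuKFiniteSectionWhittakerAsXiDerivatives   -- ★ (V-4b) `…_hLine_uniform`: `W_h(s;f)` as `h`-line jets of ξ, ANY hermitian `h`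
import Summits.HodgeConjecture.HodgeConjecture.Theorems.K2LiuHermTwoXiIndefiniteContinuation          -- ★ FILE 4 (this seat): continuation of the order-0 jet
import HarnessLib

/-!
# Crux `HLiu418`, socket #41, KIND W — organ «Φ6b-ind», CONSUMER HEAD: the archimedean Whittaker letter `hW` at an INDEFINITE framed index

Cell `hodgecm-mathlib`, crux item hLiu418 = `stmt-HodgeConjecture-24832` (helper lane `--supports … --as helper`, count-neutral), route of record
`HCCMUnconditional`; squad K2 ∕ K2Liu, road `K2_Liu`, socket #41 `sig_K2LiuSiegelEisensteinContinuation`, KIND W.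

THE SLOT.  ★ `K2LiuKindWArchWhittakerLetterDispatch.hW_of_signCases` dispatches the per-place archimedean Whittaker letter `hW` on the sign type of the
framed index (`det ≠ 0`): the two DEFINITE heads are ★ by name (`…WhittakerLetter.exists_twistedWhittaker_continuation_of_posDef`, LH4-p08's mirror
`…WhittakerLetterNegDef.…_of_negDef`); the INDEFINITE case (signature `(1,1)`) is its by-value slot `hInd` — the definite heads' telescope ∀-closed at
`hidx'ᴴ = hidx'`, `hidx'.det.re < 0` (KW desk (G3)).  THIS FILE PROVES THAT TELESCOPE, hypothesis-first on ONE closed analytic letter: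
* **`exists_twistedWhittaker_continuation_of_indef (hJet) : ∀ k, -2 ≤ k → ∀ Q B C, … → ∃ Ew s₀, …`** — all binders of the `hInd` telescope EXPLICIT and in
  the slot's order, so the tie writes `hInd := exists_twistedWhittaker_continuation_of_indef hJet`.
THE RESIDUAL LETTER `hJet` («Φ6b-ind» (R5), the JET CONTINUATION of Shimura's ξ at an indefinite index):
  `∀ h Θ, hᴴ = h → h.det.re < 0 → Θᴴ = Θ → ∀ (e : ℕ) (a b : ℂ), ∃ F s₀, DifferentiableOn ℂ F {0 < re} ∧`
  `   ∀ s, s₀ < re s → F s = iteratedDeriv e (fun t : ℝ => xiTwo 1 (h + t•Θ) (a + s) (b + s)) 0`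
(«the `e`-th real `h`-line derivative of `s ↦ ξ(1, h; a + s, b + s)` — by ★ `iteratedDeriv_xiTwo_hLine` the `e`-th polynomial MOMENT of the ξ-integrand —
continues holomorphically to the right half-plane»).  Its ORDER-ZERO instance is ★: `hJet_zero` below, from ★ FILE 4
`exists_continuation_xiTwo_diag_rightHalfPlane` (the ξ-side Cayley recursion ★ `xiTwo_cayley_recursion`, signature-free at `det h ≠ 0`); the orders
`e ≥ 1` follow from the same recursion differentiated `e` times along `h + tΘ` (`det(h + tΘ)` is quadratic in `t`; Leibniz) — road of record, next files.
THE ROAD (★ except `hJet`): §0 frame letters (★ `antidiag_letters`, `levi_mem`); §1 arch Iwasawa `m₀·g = n(X₀)·m(R,R⁻¹)·u₀` (★ `exists_transl_levi_mul_stabilizer`)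
and the K-picture `P` of the `u₀`-translates (`hKpic`); §2 the two index changes `h₁ = C⁻ᴴ·hidx·C⁻¹`, `h₂ = Rᴴ·h₁·R` — HERMITIAN with `det.re < 0` (signature
is a congruence invariant: `re det(Rᴴ A R) = ‖det R‖²·re det A`); ★ (V-4b) `exists_whittaker_eq_sum_iteratedDeriv_hLine_uniform P k` at the hermitian `h₂`
(ANY signature): `W_{h₂}(s; f) = Σ_{j∈J} κ_j · (d∕dt)^{e_j} ξ(1, h₂ + tΘ_j; s+1−k∕2+m_j, s+1+k∕2+n_j)|₀` for `re s > s₀`; `hJet` at `(h₂, Θ_j, e_j)` continues each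
jet; §3–§4 the definite head's chart ∕ substitution ∕ translation ∕ Levi chain VERBATIM (★ `integral_hermOfReal_eq`, `integral_comp_hermTwo_conj`,
`integral_add_left_eq_self`, `whittaker_levi_equivariance`).  Value: `Ew s = ⅛‖det C‖⁻⁴ e(tr h₁X₀) χ_k(det R⁻¹) ‖det R‖^{2−2s} Σ_j κ_j F_j(s)`.
[Shimura1982, §3 Thm. 3.1, §4 Thm. 4.2] [Shimura1997, §16.4, §18.4] [KudlaRallis1994, §1].
HONEST LABEL.  Count-neutral helper; it moves the indefinite `hW` onto ONE closed letter `hJet` whose order-0 instance is ★ (orders ≥ 1 OPEN, road above);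
no decay∕growth statement is needed or claimed; `HC_CM` is proved only modulo the 7 printed citations (2 remaining named inputs: hLiu418 =
`stmt-HodgeConjecture-24832`, h413 = `stmt-HodgeConjecture-24833`) until rung 0 closes.

## References
* [Shimura1982] G. Shimura, *Confluent hypergeometric functions on tube domains*, Math. Ann. 260 (1982) 269–302: §3 Thm. 3.1, §4 Thm. 4.2.
* [Shimura1997] G. Shimura, *Euler Products and Eisenstein Series*, CBMS 93 (1997): §16.4, §18.4.
* [KudlaRallis1994] S. Kudla, S. Rallis, *A regularized Siegel–Weil formula: the first term identity*, Ann. of Math. 140 (1994): §1.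
-/

set_option autoImplicit false
set_option linter.dupNamespace false -- the mandated namespace repeats `HodgeConjecture.HodgeConjecture`

noncomputable section

open Complex Matrix MeasureTheory
open scoped ComplexConjugate ComplexOrder
open Literature.NumberTheory.ModularForms.SiegelUpperHalfSpace (moeb)

namespace Summit.HodgeConjecture.HodgeConjecture.Cruxes.HLiu418.K2LiuKindWArchIndefiniteLetter

open Summit.HodgeConjecture.HodgeConjecture.Cruxes.HLiu418.K2LiuHermTwoGammaDefs (hermTwo hermTwo_eq_of_isHermitian)
open Summit.HodgeConjecture.HodgeConjecture.Cruxes.HLiu418.K2LiuHermTwoConfluentXiDefs (xiTwo)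
open Summit.HodgeConjecture.HodgeConjecture.Cruxes.HLiu418.K2LiuHermTwoEtaDefs (hermTwo_add)
open Summit.HodgeConjecture.HodgeConjecture.Cruxes.HLiu418.K2LiuHermitianTubeCocycle (mul_mem_UJ J_mem)
open Summit.HodgeConjecture.HodgeConjecture.Cruxes.HLiu418.K2LiuHermitianTubeAction (exists_transl_levi_mul_stabilizer)
open Summit.HodgeConjecture.HodgeConjecture.Cruxes.HLiu418.K2LiuArchInducedTubeDefs
open Summit.HodgeConjecture.HodgeConjecture.Cruxes.HLiu418.K2LiuU22CompactPictureDefs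
open Summit.HodgeConjecture.HodgeConjecture.Cruxes.HLiu418.K2LiuArchWhittakerLeviEquivariance
open Summit.HodgeConjecture.HodgeConjecture.Cruxes.HLiu418.K2LiuArchIntertwiningScalarValue (integral_hermOfReal_eq)
open Summit.HodgeConjecture.HodgeConjecture.Cruxes.HLiu418.K2LiuArchBlockOfFrame (antidiag_letters antidiag_eq_J_mul_levi levi_mul_transl)
open Summit.HodgeConjecture.HodgeConjecture.Cruxes.HLiu418.K2LiuKFiniteSectionWhittakerAsXiDerivatives (exists_whittaker_eq_sum_iteratedDeriv_hLine_uniform)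
open Summit.HodgeConjecture.HodgeConjecture.Cruxes.HLiu418.K2LiuHermTwoXiIndefiniteContinuation (exists_continuation_xiTwo_diag_rightHalfPlane)
open Summit.HodgeConjecture.HodgeConjecture.Cruxes.HLiu418.K2LiuKindWArchWhittakerLetterDispatch (hW_of_signCases)

/-! ## §0 The residual letter at order `0` is ★; the signature of a congruence -/

/-- **THE ORDER-ZERO INSTANCE OF THE RESIDUAL LETTER `hJet` IS ★**: for `h` hermitian with `det h < 0`, any `Θ` and `a b : ℂ`, `s ↦ ξ(1, h; a + s, b + s)`
(the `0`-th `h`-line jet) continues holomorphically to `{0 < re s}` — ★ FILE 4 `exists_continuation_xiTwo_diag_rightHalfPlane` (the ξ-side Cayley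
recursion, signature-free at `det h ≠ 0`). [cite: Shimura1982, §4 Thm. 4.2] -/
theorem hJet_zero (h Θ : Matrix (Fin 2) (Fin 2) ℂ) (hherm : hᴴ = h) (hind : h.det.re < 0) (_hΘ : Θᴴ = Θ) (a b : ℂ) :
    ∃ (F : ℂ → ℂ) (s₀ : ℝ), DifferentiableOn ℂ F {s : ℂ | 0 < s.re} ∧
      ∀ s : ℂ, s₀ < s.re → F s = iteratedDeriv 0 (fun t : ℝ => xiTwo 1 (h + (t : ℂ) • Θ) (a + s) (b + s)) 0 := by
  have hdet : h.det ≠ 0 := fun h0 => by rw [h0, Complex.zero_re] at hind; exact lt_irrefl _ hind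
  obtain ⟨F, hFd, hF⟩ := exists_continuation_xiTwo_diag_rightHalfPlane Matrix.PosDef.one hherm hdet a b
  refine ⟨F, (3 - (a + b).re) / 2, hFd, fun s hs => ?_⟩
  simp only [iteratedDeriv_zero, Complex.ofReal_zero, zero_smul, add_zero]
  exact hF s (by simp only [Complex.add_re, two_mul] at hs ⊢; linarith)

/-- `re(z̄·w·z) = |z|²·re w`. [folklore] -/
theorem re_star_mul_mul (z w : ℂ) : (star z * w * z).re = Complex.normSq z * w.re := by
  rw [Complex.star_def, show conj z * w * z = (conj z * z) * w by ring, ← Complex.normSq_eq_conj_mul_self, Complex.re_ofReal_mul]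

/-- **THE SIGN OF `det` IS A CONGRUENCE INVARIANT**: `re det(Rᴴ·A·R) = ‖det R‖²·re det A`; in particular `det.re < 0` is preserved by an invertible
congruence. [folklore] -/
theorem det_re_conjTranspose_mul_mul_neg {A R : Matrix (Fin 2) (Fin 2) ℂ} (hA : A.det.re < 0) (hR : R.det ≠ 0) :
    (Rᴴ * A * R).det.re < 0 := by
  rw [det_mul, det_mul, det_conjTranspose, re_star_mul_mul]
  exact mul_neg_of_pos_of_neg (Complex.normSq_pos.2 hR) hA

/-! ## §1 HEAD — the `hInd` telescope of ★ `hW_of_signCases`, from the jet-continuation letter `hJet` -/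

/-- **THE PER-PLACE ARCHIMEDEAN WHITTAKER LETTER AT AN INDEFINITE FRAMED INDEX** (the `hInd` slot of ★ `K2LiuKindWArchWhittakerLetterDispatch.hW_of_signCases`,
all its binders explicit and in the slot's order; the tie writes `hInd := exists_twistedWhittaker_continuation_of_indef hJet`).  Data at one complex place:
a weight `k` (the window `-2 ≤ k` is carried for the slot and not used), a compact picture `Q`, the frame image `x = (0 B; C 0) ∈ U(J)`, `g ∈ U(J)`, a HERMITIAN
framed index `hidx` with `re det hidx < 0` (signature `(1,1)`; KW desk (G3) bytes), the twist `eb` with its reading, and the algebraic bridge `hKpic` (★ W1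
`kPicture_rightTranslate`).  BY VALUE, FIRST: the jet-continuation letter `hJet` (module docstring; order `0` ★ `hJet_zero`).  CONCLUSION: `∃ Ew s₀`, `Ew`
holomorphic on `{0 < re s}`, with `∫_{Herm₂} F(x·n(b)·g)·eb(b) db = Ew s` for `s₀ < re s` and every section `F ∈ I_w(s, χ_k)` of compact picture `Q`.
Road: the definite head's frame algebra ∕ chart ∕ substitution ∕ Iwasawa ∕ Levi chain verbatim; the indices `h₁ = C⁻ᴴ·hidx·C⁻¹`, `h₂ = Rᴴ·h₁·R` stay hermitian
with `det.re < 0`; ★ (V-4b) `exists_whittaker_eq_sum_iteratedDeriv_hLine_uniform` at `h₂` writes `W_{h₂}(s; f)` as `Σ_j κ_j·(jet_j)(s)`; `hJet` continues each jet.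
[cite: Shimura1997, §16.4, §18.4] [cite: Shimura1982, §4 Thm. 4.2] [cite: KudlaRallis1994, §1] -/
theorem exists_twistedWhittaker_continuation_of_indef
    (hJet : ∀ (h Θ : Matrix (Fin 2) (Fin 2) ℂ), hᴴ = h → h.det.re < 0 → Θᴴ = Θ → ∀ (e : ℕ) (a b : ℂ),
      ∃ (F : ℂ → ℂ) (s₀ : ℝ), DifferentiableOn ℂ F {s : ℂ | 0 < s.re} ∧
        ∀ s : ℂ, s₀ < s.re → F s = iteratedDeriv e (fun t : ℝ => xiTwo 1 (h + (t : ℂ) • Θ) (a + s) (b + s)) 0)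
    (k : ℤ) (_hk : -2 ≤ k) (Q : Carrier) (B C : Matrix (Fin 2) (Fin 2) ℂ)
    (hx : (fromBlocks 0 B C 0 : Matrix (Fin 2 ⊕ Fin 2) (Fin 2 ⊕ Fin 2) ℂ)ᴴ * Matrix.J (Fin 2) ℂ * (fromBlocks 0 B C 0 : Matrix (Fin 2 ⊕ Fin 2) (Fin 2 ⊕ Fin 2) ℂ) =
      Matrix.J (Fin 2) ℂ)
    (g : Matrix (Fin 2 ⊕ Fin 2) (Fin 2 ⊕ Fin 2) ℂ) (hg : gᴴ * Matrix.J (Fin 2) ℂ * g = Matrix.J (Fin 2) ℂ)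
    (hidx : Matrix (Fin 2) (Fin 2) ℂ) (hherm : hidxᴴ = hidx) (hind : hidx.det.re < 0)
    (eb : Matrix (Fin 2) (Fin 2) ℂ → ℂ) (heb : ∀ b, eb b = cexp (-(2 * Real.pi * I) * (hidx * b).trace))
    (hKpic : ∀ k₀ : Matrix (Fin 2 ⊕ Fin 2) (Fin 2 ⊕ Fin 2) ℂ, k₀ᴴ * Matrix.J (Fin 2) ℂ * k₀ = Matrix.J (Fin 2) ℂ →
      moeb k₀ (I • (1 : Matrix (Fin 2) (Fin 2) ℂ)) = I • 1 →
      ∃ P : MvPolynomial (((Fin 2 ⊕ Fin 2) × (Fin 2 ⊕ Fin 2)) ⊕ ((Fin 2 ⊕ Fin 2) × (Fin 2 ⊕ Fin 2))) ℂ,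
        ∀ (s : ℂ) (F : Matrix (Fin 2 ⊕ Fin 2) (Fin 2 ⊕ Fin 2) ℂ → ℂ), IsArchSiegelSection (fun z : ℂ => (conj z / ((‖z‖ : ℝ) : ℂ)) ^ k) s F →
          (∀ (v : Matrix (Fin 2) (Fin 2) ℂ), vᴴ * v = 1 → ∀ hv : v.det ≠ 0,
            F ((2 : ℂ)⁻¹ • fromBlocks (1 + v) (-(I • (1 - v))) (I • (1 - v)) (1 + v) : Matrix (Fin 2 ⊕ Fin 2) (Fin 2 ⊕ Fin 2) ℂ) = evalAt v hv Q) →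
          ∀ u : Matrix (Fin 2 ⊕ Fin 2) (Fin 2 ⊕ Fin 2) ℂ, uᴴ * Matrix.J (Fin 2) ℂ * u = Matrix.J (Fin 2) ℂ → moeb u (I • (1 : Matrix (Fin 2) (Fin 2) ℂ)) = I • 1 →
            F (u * k₀) = MvPolynomial.eval (Sum.elim (fun pq => u pq.1 pq.2) (fun pq => conj (u pq.1 pq.2))) P) :
    ∃ (Ew : ℂ → ℂ) (s₀ : ℝ), DifferentiableOn ℂ Ew {s : ℂ | 0 < s.re} ∧ ∀ s : ℂ, s₀ < s.re →
      ∀ F : Matrix (Fin 2 ⊕ Fin 2) (Fin 2 ⊕ Fin 2) ℂ → ℂ, IsArchSiegelSection (fun z : ℂ => (conj z / ((‖z‖ : ℝ) : ℂ)) ^ k) s F →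
        (∀ (v : Matrix (Fin 2) (Fin 2) ℂ), vᴴ * v = 1 → ∀ hv : v.det ≠ 0,
          F ((2 : ℂ)⁻¹ • fromBlocks (1 + v) (-(I • (1 - v))) (I • (1 - v)) (1 + v) : Matrix (Fin 2 ⊕ Fin 2) (Fin 2 ⊕ Fin 2) ℂ) = evalAt v hv Q) →
        ∫ r : Fin 2 → Fin 2 → ℝ, F ((fromBlocks 0 B C 0 : Matrix (Fin 2 ⊕ Fin 2) (Fin 2 ⊕ Fin 2) ℂ) * fromBlocks 1 (hermOfReal r) 0 1 * g) * eb (hermOfReal r) =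
          Ew s := by
  classical
  /- §0 frame letters -/
  obtain ⟨hCB, hBC⟩ := antidiag_letters hx
  have hC : C.det ≠ 0 := (Matrix.isUnit_det_of_left_inverse hBC).ne_zero
  have hCu : IsUnit C.det := isUnit_iff_ne_zero.2 hC
  have hCiC : C⁻¹ * C = 1 := Matrix.nonsing_inv_mul C hCu
  have hCCi : C * C⁻¹ = 1 := Matrix.mul_nonsing_inv C hCu
  have hm₀ := levi_mem hBC                                   -- `m₀ := diag(C, −B) ∈ U(J)`
  have hg' := mul_mem_UJ hm₀ hg                              -- `g' := m₀ · g ∈ U(J)`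
  /- §1 arch Iwasawa of `g'` and the K-picture of the `u₀`-translates -/
  obtain ⟨X₀, R, u₀, hX₀, hR, hRu, hu₀J, hu₀i, hg'eq⟩ := exists_transl_levi_mul_stabilizer hg'
  obtain ⟨P, hP⟩ := hKpic u₀ hu₀J hu₀i
  have hRRi : R * R⁻¹ = 1 := Matrix.mul_nonsing_inv R hRu
  have had : Rᴴ * R⁻¹ = 1 := by rw [hR, hRRi]
  have hRdet : R.det ≠ 0 := hRu.ne_zero
  /- §2 the two index changes: hermitian, `det.re < 0` -/
  set h₁ : Matrix (Fin 2) (Fin 2) ℂ := (C⁻¹)ᴴ * hidx * C⁻¹ with h₁def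
  set h₂ : Matrix (Fin 2) (Fin 2) ℂ := Rᴴ * h₁ * R with h₂def
  have hCidet : (C⁻¹).det ≠ 0 := (Matrix.isUnit_det_of_right_inverse hCiC).ne_zero
  have hh₁ : h₁.IsHermitian := Matrix.isHermitian_conjTranspose_mul_mul C⁻¹ (hherm : hidx.IsHermitian)
  have hh₂ : h₂.IsHermitian := Matrix.isHermitian_conjTranspose_mul_mul R hh₁
  have hdet₁ : h₁.det.re < 0 := det_re_conjTranspose_mul_mul_neg hind hCidet
  have hdet₂ : h₂.det.re < 0 := det_re_conjTranspose_mul_mul_neg hdet₁ hRdet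
  /- ★ (V-4b) at the hermitian `h₂`: `W_{h₂}(s; f)` as a finite combination of `h`-line jets of ξ; the jets' continuations by `hJet` -/
  obtain ⟨J, κ, m, n, s₀, hV⟩ := exists_whittaker_eq_sum_iteratedDeriv_hLine_uniform P k
  choose Fj s₁ hFjd hFj using fun j : (Σ _ : ((Fin 2 × Fin 2) ⊕ (Fin 2 × Fin 2)) →₀ ℕ, {M : Matrix (Fin 2) (Fin 2) ℂ // M.IsHermitian} × ℕ) =>
    hJet h₂ (j.2.1 : Matrix (Fin 2) (Fin 2) ℂ) hh₂ hdet₂ j.2.1.2 j.2.2 (1 - (k : ℂ) / 2 + (m j : ℂ)) (1 + (k : ℂ) / 2 + (n j : ℂ))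
  have hopen : IsOpen {s : ℂ | 0 < s.re} := isOpen_lt continuous_const Complex.continuous_re
  /- §3 the constants -/
  set χ : ℂ → ℂ := fun z : ℂ => (conj z / ((‖z‖ : ℝ) : ℂ)) ^ k with hχ
  set K₀ : ℂ := cexp ((2 * Real.pi * I) * (h₁ * X₀).trace) with hK₀
  have hRpos : 0 < ‖R.det‖ := norm_pos_iff.2 hRdet
  refine ⟨fun s => (1 / 8 : ℂ) * (((((‖C.det‖ : ℝ) : ℂ) ^ 4)⁻¹) * (K₀ * (χ R⁻¹.det * (((‖R.det‖ : ℝ) : ℂ) ^ (2 - 2 * s) * ∑ j ∈ J, κ j * Fj j s)))),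
    max s₀ (∑ j ∈ J, max (s₁ j) 0), ?_, fun s hs F hF hFQ => ?_⟩
  · -- holomorphy on `{0 < re}`
    have hpow : Differentiable ℂ (fun s : ℂ => ((‖R.det‖ : ℝ) : ℂ) ^ (2 - 2 * s)) :=
      Differentiable.const_cpow ((differentiable_const _).sub ((differentiable_const _).mul differentiable_id))
        (Or.inl (ofReal_ne_zero.2 hRpos.ne'))
    have hsum : DifferentiableOn ℂ (fun s : ℂ => ∑ j ∈ J, κ j * Fj j s) {s : ℂ | 0 < s.re} :=
      DifferentiableOn.fun_sum fun j _ => (differentiableOn_const _).mul (hFjd j)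
    exact (differentiableOn_const _).mul ((differentiableOn_const _).mul ((differentiableOn_const _).mul
      ((differentiableOn_const _).mul (hpow.differentiableOn.mul hsum))))
  · /- §4 the identity at `max s₀ (Σ_j max (s₁ j) 0) < re s` -/
    have hs₀ : s₀ < s.re := lt_of_le_of_lt (le_max_left _ _) hs
    have hs₁ : ∀ j ∈ J, s₁ j < s.re := fun j hj => by
      have h1 : max (s₁ j) 0 ≤ ∑ j ∈ J, max (s₁ j) 0 :=
        Finset.single_le_sum (f := fun j => max (s₁ j) 0) (fun _ _ => le_max_right _ _) hj
      have h2 := le_max_left (s₁ j) 0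
      have h3 := le_max_right s₀ (∑ j ∈ J, max (s₁ j) 0)
      linarith
    -- the right translate by `u₀` is a section with polynomial K-picture `P`
    set f : Matrix (Fin 2 ⊕ Fin 2) (Fin 2 ⊕ Fin 2) ℂ → ℂ := fun y => F (y * u₀) with hf
    have hfS : IsArchSiegelSection χ s f := isArchSiegelSection_rightTranslate hF u₀
    have hfK : ∀ u : Matrix (Fin 2 ⊕ Fin 2) (Fin 2 ⊕ Fin 2) ℂ, uᴴ * Matrix.J (Fin 2) ℂ * u = Matrix.J (Fin 2) ℂ →
        moeb u (I • (1 : Matrix (Fin 2) (Fin 2) ℂ)) = I • 1 →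
        f u = MvPolynomial.eval (Sum.elim (fun pq => u pq.1 pq.2) (fun pq => conj (u pq.1 pq.2))) P :=
      fun u hu hui => hP s F hF hFQ u hu hui
    -- the twist read at `h₁`: `eb X = e₁ (C X Cᴴ)`
    have heb₁ : ∀ X : Matrix (Fin 2) (Fin 2) ℂ, eb X = cexp (-(2 * Real.pi * I) * (h₁ * (C * X * Cᴴ)).trace) := by
      intro X
      rw [heb, trace_mul_conj h₁ C X, h₁def]
      congr 3
      rw [show Cᴴ * ((C⁻¹)ᴴ * hidx * C⁻¹) * C = (C⁻¹ * C)ᴴ * hidx * (C⁻¹ * C) by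
        rw [Matrix.conjTranspose_mul]; simp only [Matrix.mul_assoc], hCiC, Matrix.conjTranspose_one, Matrix.one_mul, Matrix.mul_one]
    -- the frame algebra: `x · n(X) · g = J · n(C X Cᴴ) · g'`
    have e1 : ∀ X : Matrix (Fin 2) (Fin 2) ℂ, (fromBlocks 0 B C 0 : Matrix (Fin 2 ⊕ Fin 2) (Fin 2 ⊕ Fin 2) ℂ) * fromBlocks 1 X 0 1 * g =
        Matrix.J (Fin 2) ℂ * fromBlocks 1 (C * X * Cᴴ) 0 1 * (fromBlocks C 0 0 (-B) * g) := by
      intro X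
      rw [antidiag_eq_J_mul_levi, Matrix.mul_assoc (Matrix.J (Fin 2) ℂ), levi_mul_transl hCB, ← Matrix.mul_assoc (Matrix.J (Fin 2) ℂ),
        Matrix.mul_assoc _ _ g]
    -- the Iwasawa rewriting: `J · n(Y) · g' = (J · n(Y + X₀) · m(R,R⁻¹)) · u₀`
    have e2 : ∀ Y : Matrix (Fin 2) (Fin 2) ℂ, Matrix.J (Fin 2) ℂ * fromBlocks 1 Y 0 1 * (fromBlocks C 0 0 (-B) * g) =
        Matrix.J (Fin 2) ℂ * fromBlocks 1 (Y + X₀) 0 1 * fromBlocks R 0 0 R⁻¹ * u₀ := by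
      intro Y
      have hn : (fromBlocks 1 Y 0 1 : Matrix (Fin 2 ⊕ Fin 2) (Fin 2 ⊕ Fin 2) ℂ) * fromBlocks 1 X₀ 0 1 = fromBlocks 1 (Y + X₀) 0 1 := by
        rw [fromBlocks_multiply]; simp [add_comm]
      rw [hg'eq, ← hn]
      simp only [Matrix.mul_assoc]
    -- the twisted integrand in the two charts
    set G : Matrix (Fin 2) (Fin 2) ℂ → ℂ := fun Y =>
      F (Matrix.J (Fin 2) ℂ * fromBlocks 1 Y 0 1 * (fromBlocks C 0 0 (-B) * g)) * cexp (-(2 * Real.pi * I) * (h₁ * Y).trace) with hG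
    set c₀ : ℝ × ℂ × ℝ := ((X₀ 0 0).re, X₀ 0 1, (X₀ 1 1).re) with hc₀
    have hX₀c : hermTwo c₀ = X₀ := hermTwo_eq_of_isHermitian hX₀
    set G₂ : ℝ × ℂ × ℝ → ℂ := fun c =>
      f (Matrix.J (Fin 2) ℂ * fromBlocks 1 (hermTwo c) 0 1 * fromBlocks R 0 0 R⁻¹) * cexp (-(2 * Real.pi * I) * (h₁ * hermTwo c).trace) * K₀ with hG₂
    -- Step A+B: chart and frame algebra, pointwise
    have hAB : ∀ X : Matrix (Fin 2) (Fin 2) ℂ,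
        F ((fromBlocks 0 B C 0 : Matrix (Fin 2 ⊕ Fin 2) (Fin 2 ⊕ Fin 2) ℂ) * fromBlocks 1 X 0 1 * g) * eb X = G (C * X * Cᴴ) := by
      intro X; rw [hG, e1, heb₁]
    -- Step D pointwise: `G (hermTwo c) = G₂ (c₀ + c)`
    have hD : ∀ c : ℝ × ℂ × ℝ, G (hermTwo c) = G₂ (c₀ + c) := by
      intro c
      have hY : hermTwo (c₀ + c) = hermTwo c + X₀ := by rw [hermTwo_add, hX₀c, add_comm]
      simp only [hG, hG₂, hf]
      rw [e2, hY, mul_assoc (F _)]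
      congr 1
      rw [hK₀, ← Complex.exp_add]
      congr 1
      rw [Matrix.mul_add, Matrix.trace_add]
      ring
    -- the jets at `h₂`, continued: `Σ_j κ_j · jet_j(s) = Σ_j κ_j · F_j(s)`
    have hJ : ∑ j ∈ J, κ j * iteratedDeriv j.2.2
          (fun t : ℝ => xiTwo 1 (h₂ + (t : ℂ) • (j.2.1 : Matrix (Fin 2) (Fin 2) ℂ)) (s + 1 - k / 2 + m j) (s + 1 + k / 2 + n j)) 0 =
        ∑ j ∈ J, κ j * Fj j s := by
      refine Finset.sum_congr rfl fun j hj => ?_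
      have ea : 1 - (k : ℂ) / 2 + (m j : ℂ) + s = s + 1 - k / 2 + m j := by ring
      have eb' : 1 + (k : ℂ) / 2 + (n j : ℂ) + s = s + 1 + k / 2 + n j := by ring
      rw [hFj j s (hs₁ j hj), ea, eb']
    -- Lebesgue measure on the chart `ℝ × ℂ × ℝ` is an additive Haar measure (as in ★ `integral_hermOfReal_eq`)
    haveI hCvol : ((volume : Measure ℂ).prod (volume : Measure ℝ)).IsAddHaarMeasure := Measure.prod.instIsAddHaarMeasure _ _
    haveI : (volume : Measure (ℝ × ℂ × ℝ)).IsAddHaarMeasure := by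
      rw [show (volume : Measure (ℝ × ℂ × ℝ)) = (volume : Measure ℝ).prod ((volume : Measure ℂ).prod (volume : Measure ℝ)) from rfl]
      exact Measure.prod.instIsAddHaarMeasure _ _
    calc ∫ r : Fin 2 → Fin 2 → ℝ, F ((fromBlocks 0 B C 0 : Matrix (Fin 2 ⊕ Fin 2) (Fin 2 ⊕ Fin 2) ℂ) * fromBlocks 1 (hermOfReal r) 0 1 * g) * eb (hermOfReal r)
        = (1 / 8 : ℂ) * ∫ c : ℝ × ℂ × ℝ, G (C * hermTwo c * Cᴴ) := by
          rw [integral_hermOfReal_eq (fun X => F ((fromBlocks 0 B C 0 : Matrix (Fin 2 ⊕ Fin 2) (Fin 2 ⊕ Fin 2) ℂ) * fromBlocks 1 X 0 1 * g) * eb X)]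
          simp only [hAB]
      _ = (1 / 8 : ℂ) * ((((‖C.det‖ : ℝ) : ℂ) ^ 4)⁻¹ * ∫ c : ℝ × ℂ × ℝ, G (hermTwo c)) := by
          congr 1
          rw [integral_comp_hermTwo_conj hC G, Complex.real_smul, ofReal_pow, ← mul_assoc,
            inv_mul_cancel₀ (pow_ne_zero _ (ofReal_ne_zero.2 (norm_pos_iff.2 hC).ne')), one_mul]
      _ = (1 / 8 : ℂ) * ((((‖C.det‖ : ℝ) : ℂ) ^ 4)⁻¹ * ∫ c : ℝ × ℂ × ℝ, G₂ c) := by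
          simp only [hD]
          rw [integral_add_left_eq_self G₂ c₀]
      _ = (1 / 8 : ℂ) * ((((‖C.det‖ : ℝ) : ℂ) ^ 4)⁻¹ * (K₀ *
            ∫ c : ℝ × ℂ × ℝ, f (Matrix.J (Fin 2) ℂ * fromBlocks 1 (hermTwo c) 0 1 * fromBlocks R 0 0 R⁻¹) *
              cexp (-(2 * Real.pi * I) * (h₁ * hermTwo c).trace))) := by
          rw [hG₂, integral_mul_const, mul_comm _ K₀]
      _ = (1 / 8 : ℂ) * ((((‖C.det‖ : ℝ) : ℂ) ^ 4)⁻¹ * (K₀ * (χ R⁻¹.det * (((‖R.det‖ : ℝ) : ℂ) ^ (2 - 2 * s) *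
            ∫ c : ℝ × ℂ × ℝ, f (Matrix.J (Fin 2) ℂ * fromBlocks 1 (hermTwo c) 0 1) * cexp (-(2 * Real.pi * I) * (h₂ * hermTwo c).trace))))) := by
          rw [whittaker_levi_equivariance hfS had h₁, h₂def, mul_assoc (χ R⁻¹.det)]
      _ = (1 / 8 : ℂ) * ((((‖C.det‖ : ℝ) : ℂ) ^ 4)⁻¹ * (K₀ * (χ R⁻¹.det * (((‖R.det‖ : ℝ) : ℂ) ^ (2 - 2 * s) * ∑ j ∈ J, κ j * Fj j s)))) := by
          rw [hV h₂ hh₂ s hs₀ f hfS hfK, hJ]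

/-! ## §2 The tie: ★ `hW_of_signCases` with its `hInd` slot PAID by §1 (modulo `hJet`) -/

/-- **THE PER-PLACE ARCHIMEDEAN WHITTAKER LETTER `hW` BY SIGN CASES, THE INDEFINITE SLOT PAID** (★ `K2LiuKindWArchWhittakerLetterDispatch.hW_of_signCases` with
`hInd := exists_twistedWhittaker_continuation_of_indef hJet`; every other binder and the conclusion VERBATIM): the letter `hW` at EVERY non-degenerate framed
index now rests on the definite heads (★), the window `hk`, the frame∕index readings, `hWhol`, and the ONE jet-continuation letter `hJet` (order `0` ★ `hJet_zero`).
[cite: Shimura1997, §16.4, §18.4] [cite: Shimura1982, §4 Thm. 4.2] -/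
theorem hW_of_signCases_of_hJet {ιS ιh W : Type*} (good : ιS → Prop) (k : W → ℤ) (hk : ∀ w, -2 ≤ k w)
    (B C : W → Matrix (Fin 2) (Fin 2) ℂ)
    (hx : ∀ w, (fromBlocks 0 (B w) (C w) 0 : Matrix (Fin 2 ⊕ Fin 2) (Fin 2 ⊕ Fin 2) ℂ)ᴴ * Matrix.J (Fin 2) ℂ *
      (fromBlocks 0 (B w) (C w) 0 : Matrix (Fin 2 ⊕ Fin 2) (Fin 2 ⊕ Fin 2) ℂ) = Matrix.J (Fin 2) ℂ)
    (Pt : ιS → ιh → W → Matrix (Fin 2 ⊕ Fin 2) (Fin 2 ⊕ Fin 2) ℂ) (hPt : ∀ S h w, (Pt S h w)ᴴ * Matrix.J (Fin 2) ℂ * Pt S h w = Matrix.J (Fin 2) ℂ)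
    (eb : ιS → ιh → W → Matrix (Fin 2) (Fin 2) ℂ → ℂ) (hidx : ιS → ιh → W → Matrix (Fin 2) (Fin 2) ℂ)
    (hherm : ∀ S h w, (hidx S h w)ᴴ = hidx S h w) (hdet : ∀ S, good S → ∀ h w, (hidx S h w).det ≠ 0)
    (hebr : ∀ S h w (b : Matrix (Fin 2) (Fin 2) ℂ), eb S h w b = cexp (-(2 * Real.pi * I) * (hidx S h w * b).trace))
    (s₁ : ℝ) (hs₁ : 0 ≤ s₁)
    (hWhol : ∀ (S : ιS), good S → ∀ (h : ιh) (w : W) (Q : Carrier), ∀ s' : ℂ, s₁ < s'.re → ∀ F₀ : Matrix (Fin 2 ⊕ Fin 2) (Fin 2 ⊕ Fin 2) ℂ → ℂ,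
      IsArchSiegelSection (fun z : ℂ => (conj z / ((‖z‖ : ℝ) : ℂ)) ^ (k w)) s' F₀ →
      (∀ (v : Matrix (Fin 2) (Fin 2) ℂ), vᴴ * v = 1 → ∀ hv : v.det ≠ 0,
        F₀ ((2 : ℂ)⁻¹ • fromBlocks (1 + v) (-(I • (1 - v))) (I • (1 - v)) (1 + v) : Matrix (Fin 2 ⊕ Fin 2) (Fin 2 ⊕ Fin 2) ℂ) = evalAt v hv Q) →
      ∃ G : ℂ → Matrix (Fin 2 ⊕ Fin 2) (Fin 2 ⊕ Fin 2) ℂ → ℂ,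
      (∀ s : ℂ, s₁ < s.re → IsArchSiegelSection (fun z : ℂ => (conj z / ((‖z‖ : ℝ) : ℂ)) ^ (k w)) s (G s)) ∧
      (∀ s : ℂ, s₁ < s.re → ∀ (v : Matrix (Fin 2) (Fin 2) ℂ), vᴴ * v = 1 → ∀ hv : v.det ≠ 0,
        G s ((2 : ℂ)⁻¹ • fromBlocks (1 + v) (-(I • (1 - v))) (I • (1 - v)) (1 + v) : Matrix (Fin 2 ⊕ Fin 2) (Fin 2 ⊕ Fin 2) ℂ) = evalAt v hv Q) ∧
      DifferentiableOn ℂ (fun s : ℂ => ∫ r : Fin 2 → Fin 2 → ℝ,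
        G s ((fromBlocks 0 (B w) (C w) 0 : Matrix (Fin 2 ⊕ Fin 2) (Fin 2 ⊕ Fin 2) ℂ) * fromBlocks 1 (hermOfReal r) 0 1 * Pt S h w) * eb S h w (hermOfReal r))
        {s : ℂ | s₁ < s.re})
    (hJet : ∀ (h Θ : Matrix (Fin 2) (Fin 2) ℂ), hᴴ = h → h.det.re < 0 → Θᴴ = Θ → ∀ (e : ℕ) (a b : ℂ),
      ∃ (F : ℂ → ℂ) (s₀ : ℝ), DifferentiableOn ℂ F {s : ℂ | 0 < s.re} ∧
        ∀ s : ℂ, s₀ < s.re → F s = iteratedDeriv e (fun t : ℝ => xiTwo 1 (h + (t : ℂ) • Θ) (a + s) (b + s)) 0) :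
    ∀ (S : ιS), good S → ∀ (h : ιh) (w : W) (Q : Carrier), ∃ Ew : ℂ → ℂ, DifferentiableOn ℂ Ew {s : ℂ | 0 < s.re} ∧ ∀ s : ℂ, s₁ < s.re →
      ∀ F : Matrix (Fin 2 ⊕ Fin 2) (Fin 2 ⊕ Fin 2) ℂ → ℂ, IsArchSiegelSection (fun z : ℂ => (conj z / ((‖z‖ : ℝ) : ℂ)) ^ (k w)) s F →
        (∀ (v : Matrix (Fin 2) (Fin 2) ℂ), vᴴ * v = 1 → ∀ hv : v.det ≠ 0,
          F ((2 : ℂ)⁻¹ • fromBlocks (1 + v) (-(I • (1 - v))) (I • (1 - v)) (1 + v) : Matrix (Fin 2 ⊕ Fin 2) (Fin 2 ⊕ Fin 2) ℂ) = evalAt v hv Q) →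
        ∫ x : Fin 2 → Fin 2 → ℝ, F ((fromBlocks 0 (B w) (C w) 0 : Matrix (Fin 2 ⊕ Fin 2) (Fin 2 ⊕ Fin 2) ℂ) * fromBlocks 1 (hermOfReal x) 0 1 * Pt S h w) *
          eb S h w (hermOfReal x) = Ew s :=
  hW_of_signCases good k hk B C hx Pt hPt eb hidx hherm hdet hebr s₁ hs₁ hWhol (exists_twistedWhittaker_continuation_of_indef hJet)

end Summit.HodgeConjecture.HodgeConjecture.Cruxes.HLiu418.K2LiuKindWArchIndefiniteLetter

end
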